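import Summits.BirchSwinnertonDyer.Rank1Residual.GaloisImage.KolyvaginSystemsCoreRankOneEnd
import Summits.BirchSwinnertonDyer.Rank1Residual.GaloisImage.SelmerGroupFinite
import Summits.BirchSwinnertonDyer.Rank1Residual.GaloisImage.SelmerStructureTransportDual
import Summits.BirchSwinnertonDyer.Rank1Residual.GaloisImage.SelmerStructureTransportCoisotropic
import Summits.BirchSwinnertonDyer.Rank1Residual.GaloisImage.KolyvaginCoreTransverseSelfDual
import Summits.BirchSwinnertonDyer.Rank1Residual.GaloisImage.KolyvaginPrimeLocalShape
import Summits.BirchSwinnertonDyer.Rank1Residual.GaloisImage.CanonicalKolyvaginDatumAdmissible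
import Summits.BirchSwinnertonDyer.Rank1Residual.GaloisImage.PrimeChoiceSakamotoIndependent
import Literature.NumberTheory.GaloisCohomology.Sakamoto2024KolyvaginRankOneAt
import HarnessLib

/-!
# [S24] Thm. 4.4 (1) for `R = 𝔽₃`, `K = ℚ` — the `m = 1` slice of the pinned fact
# `Sakamoto2024.kolyvaginSystems_freeRankOne_zmod_three_pow`, PROVED
# (cell `b2b-bsdres`, team n1011, ROUTE-1 item R1-56 "S24(1) @ m = 1 in the kernel", row T-R1-56-S,
# FILE F = the slice instance; seats p13 (stalk half, assembly), p11 (graph half, local shapes),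
# p16 (transport), p15 (prime choices), p09 (rigidity))

HONEST FRAMING (verbatim for the cell): research route; prove what is provable now; no claim beyond
stated classes; nothing booked; no mark / label moved.  ONE theorem: the named-fact slice
`Literature.NumberTheory.GaloisCohomology.Sakamoto2024.kolyvaginSystems_freeRankOne_zmod_three_pow_at 1`
([S24] Thm. 4.4 (1) for `R = ℤ/3`, `K = ℚ`: `KS₁(T/3T, 𝓕, 𝒫)` is free of rank one over `ℤ/3` and
`κ ↦ κ_d` is bijective at every core vertex) is a THEOREM of the tree.  It does NOT prove the pinned
`∀ m` fact (levels `m ≥ 2` need Mazur–Rubin's principal-artinian theory, [MR04] not held), and it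
retires none of the (a′)/E2 debt of the deep rows (r1 §33: those run at depth `k′ = max k`).

## Assembly

Apply the single-module structure theorem `CoreRankOne.isFreeRankOneZMod_and_bijective_of_coreRankOne`
(FILE E′: existence by volume forms, row T-R1-56-S; injectivity by the connectedness of the core
graph, row T-R1-56-G) to `M = T/3T` over `ℚ` at `p = 3`, discharging its binders from the slice's:
* `hfin` — `SelmerFinite.finite_selmerGroup_of_isUnramifiedOutside` (FILE F-fin); `hfind` — from
  `hfin` and core rank one (`#H¹_𝓕 = 3 · #H¹_{𝓕^*}`, p09's count);
* `θ_M = red^D ∘ θ̄ ∘ red`, `θ′_M` and their inverse identities, `hχ`, `hcois`, the `λ^*`-clause,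
  (H.1) and (H.3) on `M` — p16's transport files (`SelmerStructureTransport*`), with `e = red`,
  `e′ = incl` (`incl ∘ red = 3⁰ = id` at `m = 1`);
* `hU`, `hT`, `hUT` — the local shapes at Sakamoto's primes for a general finite `𝔽₃`-module
  (`KolyvaginPrimeLocalShape*`, p18/p11); `hTθ` — p11's `comap_dualLocalCondition_transverse_eq_rat`;
  `hadm` — p04/p11's `FSComp.isAdmissible_of_hasCanonicalComparison_frobeniusClassPrimes`;
* `hch3`, `hL52` — p15's Chebotarev prime choices `…_three` / `…_four` (T-C55K).

References: R. Sakamoto, JTNB 36 (2024) Thm. 4.4 (1) (p. 926); K. Rubin, PCMI 18 (2011) Cor. 2.8.9;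
B. Mazur, K. Rubin, Mem. AMS 799 (2004) Thm. 4.3.x (not held), JTNB 28 (2016) §§6, 8.
-/

noncomputable section

open scoped Classical NumberField ContRepresentation
open Function NumberField IsDedekindDomain
open Literature.NumberTheory.GaloisRepresentations Literature.NumberTheory.GaloisRepresentations.DiscreteGaloisModule
  Literature.NumberTheory.GaloisCohomology
open Summit.BirchSwinnertonDyer.Rank1Residual.GaloisImage.Transport

namespace Summit.BirchSwinnertonDyer.Rank1Residual.GaloisImage

/-- **[S24] Thm. 4.4 (1) at `m = 1` (`R = 𝔽₃`, `K = ℚ`) is a theorem**: the slice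
`Sakamoto2024.kolyvaginSystems_freeRankOne_zmod_three_pow_at 1` of the pinned fact holds — for
`(T, 𝓕, 𝒫)` over `ℚ` with (H.0)–(H.3), (H.SD), `χ(𝓕) = 1`, `𝓕` cartesian and residually coisotropic
on `S(𝓕)`, Sakamoto's primes and the canonical finite–singular comparison maps, the module
`KS₁(T/3T, 𝓕, 𝒫)` is free of rank one over `ℤ/3` and `κ ↦ κ_d` is a bijection onto
`H¹_{𝓕(d)}(ℚ, T/3T)` at every level `d` with `λ^*(d) = 0`.
[cite: Sakamoto2024, Thm. 4.4 (1) (p. 926)] [cite: Rubin2011, Cor. 2.8.9 (2) (p. 25)] -/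
theorem kolyvaginSystems_freeRankOne_zmod_three_pow_at_one :
    Sakamoto2024.kolyvaginSystems_freeRankOne_zmod_three_pow_at 1 := by
  intro M _ _ _ _ Mbar _ _ _ _ _ _ _ ρ ρbar red incl τ θ inv S 𝓕 D η hred _hker hincl hirr hτμ hτq hH3
    hθ hperf hsum hur hcompl _hinf hS h𝓕 _hcart hχ hcois hP hT hD
  haveI : Fact (Nat.Prime 3) := ⟨Nat.prime_three⟩
  haveI : Fact (Nat.Prime (3 ^ 1)) := ⟨by norm_num⟩
  haveI : NeZero ((3 : ℕ) ^ 1) := ⟨by norm_num⟩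
  -- `3 · M = 0`
  have hMN : ∀ m : M, (3 ^ 1 : ℕ) • m = 0 := fun m => ZModModule.char_nsmul_eq_zero (3 ^ 1) m
  have hM : ∀ m : M, (3 : ℕ) • m = 0 := fun m => by simpa using hMN m
  have hpD : ∀ y : galoisCohomology (ρ.tateDual 3) 1, 3 • y = 0 := fun y =>
    galoisCohomology.nsmul_eq_zero_of_forall (ρ.tateDual 3)
      (fun f => DiscreteGaloisModule.TateDual.nsmul_eq_zero f) y
  -- `red` / `incl` are inverse bijections at `m = 1`
  have hee' : ∀ a : M, incl (red a) = a := fun a => by rw [hincl a]; simp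
  have he'e : ∀ b : Mbar, red (incl b) = b := fun b => by
    obtain ⟨a, rfl⟩ := hred b
    rw [hee']
  -- the residual self-duality transported to `M`
  set θ' := inverseOfBijective θ hθ with hθ'def
  have hθθ' : ∀ b, θ' (θ b) = b := inverseOfBijective_apply θ hθ
  have hθ'θ : ∀ g, θ (θ' g) = g := fun g => by
    obtain ⟨b, rfl⟩ := hθ.2 g
    rw [hθθ']
  have hΘΘ' := transportedSelfDual_left_inv red incl θ θ' hee' he'e hθθ'
  have hΘ'Θ := transportedSelfDual_right_inv red incl θ θ' hee' he'e hθ'θ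
  -- finiteness of the Selmer group (F-fin) and of the dual Selmer group (core-rank count)
  have hfin : Finite 𝓕.selmerGroup :=
    SelmerFinite.finite_selmerGroup_of_isUnramifiedOutside ρ (fun v hv => (hS v hv).2) h𝓕
  have hχM : LocalInvariants.HasCoreRank inv 𝓕 3 1 :=
    (hasCoreRank_induced_iff_comap red incl inv 𝓕 hee' he'e 3 1).mp hχ
  have hfind : Finite (inv.dualSelmerStructure ρ 𝓕).selmerGroup := by
    have h := hχM
    rw [LocalInvariants.HasCoreRank, pow_one] at h
    refine Nat.finite_of_card_ne_zero fun h0 => ?_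
    have h' : Nat.card 𝓕.selmerGroup = 0 := by rw [h, h0, mul_zero]
    exact Nat.card_pos.ne' h'
  have hcoisM := isResiduallyCoisotropic_of_induced_comap red incl inv 𝓕 hee' θ hcois
  -- the Kolyvagin primes
  set S₀ : Set (HeightOneSpectrum (𝓞 ℚ)) := {v | (Sum.inr v : Place ℚ) ∈ S} with hS₀
  have hS₀fin : S₀.Finite := (S.finite_toSet.preimage Sum.inr_injective.injOn).subset fun v hv => hv
  have hPS : ∀ q ∈ D.primes, (Sum.inr q : Place ℚ) ∉ S := fun q hq => by
    rw [hP] at hq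
    exact hq.1
  have hτq3 : Nonempty (cokerSubOne ρ τ ≃+ ZMod 3) := by simpa using hτq
  have hU : ∀ q ∈ D.primes, Nat.card (unramifiedSubgroup (GaloisRep.toLocal q ρ) 1) = 3 :=
    fun q hq => (natCard_unramifiedSubgroup_toLocal_of_primes_eq ρ hP hτq q hq).trans (pow_one 3)
  have hTr : ∀ q ∈ D.primes, Nat.card (D.transverse (Sum.inr q)) = 3 :=
    fun q hq => (natCard_transverse_rat_of_primes_eq_of_smul_eq_zero' ρ hP hT hτq hτμ hMN q hq).trans
      (pow_one 3)
  have hUT := unramifiedSubgroup_sup_transverse_eq_top_rat_of_primes_eq_of_smul_eq_zero' ρ hP hT hτμ hMN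
  have hTθ := CoreRankOne.comap_dualLocalCondition_transverse_eq_rat
    ((tateDualComap red).comp (θ.comp red)) (incl.comp (θ'.comp (tateDualComap incl))) (by decide : Odd 3)
    hperf hur hM hΘΘ' hS hPS hP hT hτμ hMN
  have hadm : D.IsAdmissible :=
    FSComp.isAdmissible_of_hasCanonicalComparison_frobeniusClassPrimes ρ (3 ^ 1) S₀ hτq hτμ hP hD
  -- the prime choices on `M` (Chebotarev, T-C55K), through (H.1) and (H.3) transported to `M`
  have hirrM := irreducible_of_equiv red incl hee' hirr
  have hH3M := h3_of_equiv red incl hee' (3 ^ 1) hH3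
  have hirrM' : ∀ A : AddSubgroup M,
      (∀ (s : Field.absoluteGaloisGroup ℚ), ∀ m ∈ A, ρ s m ∈ A) → A = ⊥ ∨ A = ⊤ :=
    fun A hA => hirrM A fun s m hm => hA s m hm
  have hch3 : ∀ c₁ c₂ c₃ : galoisCohomology ρ 1, c₁ ≠ 0 → c₂ ≠ 0 → c₃ ≠ 0 →
      {q ∈ D.primes | galoisCohomology.localization ρ (Sum.inr q) 1 c₁ ≠ 0 ∧
        galoisCohomology.localization ρ (Sum.inr q) 1 c₂ ≠ 0 ∧
        galoisCohomology.localization ρ (Sum.inr q) 1 c₃ ≠ 0}.Infinite := by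
    rw [hP]
    exact PrimeChoice.infinite_setOf_mem_frobeniusClassPrimes_localization_ne_zero_three ρ le_rfl
      (by norm_num) S₀ hS₀fin hτq3 hirrM' hH3M
  have hL52 : ∀ c₁ c₂ c₃ c₄ : galoisCohomology ρ 1,
      (∀ a : Fin 3 → ZMod 3, (∑ i, (a i).val • ![c₁, c₂, c₃] i) = 0 → a = 0) → c₄ ≠ 0 →
      {q ∈ D.primes | galoisCohomology.localization ρ (Sum.inr q) 1 c₁ ≠ 0 ∧
        galoisCohomology.localization ρ (Sum.inr q) 1 c₂ ≠ 0 ∧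
        galoisCohomology.localization ρ (Sum.inr q) 1 c₃ ≠ 0 ∧
        galoisCohomology.localization ρ (Sum.inr q) 1 c₄ ≠ 0}.Infinite := by
    intro c₁ c₂ c₃ c₄ hind hc₄
    rw [hP]
    exact PrimeChoice.infinite_setOf_mem_frobeniusClassPrimes_localization_ne_zero_four ρ le_rfl (by norm_num)
      S₀ hS₀fin hτq3 hirrM' hH3M c₁ c₂ c₃ c₄ hind hc₄
  -- the single-module structure theorem
  have main := CoreRankOne.isFreeRankOneZMod_and_bijective_of_coreRankOne hperf hsum hcompl hur hM hS h𝓕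
    hfin hfind _ _ hΘΘ' hΘ'Θ hcoisM hχM hPS hU hTr hUT hTθ hch3 hL52 hadm
  refine ⟨by rw [pow_one]; exact main.1, fun d hd hlam => main.2 d hd ?_⟩
  -- the `λ^*`-clause: `λ^*((𝓕(d))̄) = 0 ↔ H¹_{𝓕(d)^*} = 0` (finiteness of `H¹_{𝓕(d)^*}` from the core count)
  haveI : Finite (inv.dualSelmerStructure ρ (D.atLevel 𝓕 d)).selmerGroup := by
    haveI := CoreRankZero.finite_selmerGroup_atLevel D 𝓕 hfin d
    have h := CoreRankOne.natCard_selmerGroup_atLevel_eq_mul hperf hsum hcompl hM hS h𝓕 hfin hfind hχM hPS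
      hU hTr hd
    refine Nat.finite_of_card_ne_zero fun h0 => ?_
    have h' : Nat.card (D.atLevel 𝓕 d).selmerGroup = 0 := by rw [h, h0, mul_zero]
    exact Nat.card_pos.ne' h'
  exact (lambdaStar_induced_eq_zero_iff_comap red incl inv (D.atLevel 𝓕 d) hee' he'e hpD).mp hlam

end Summit.BirchSwinnertonDyer.Rank1Residual.GaloisImage

end
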